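import Summits.Ventures.Crystal3D.Theorems.StickyWulffConstantNoReconstructionGainLineCount
import HarnessLib

/-!
# Lines of a general rank-3 frame through a slab window: the `(V, D)` line count
# (crux `GenericWallFloor`, stmt-Ventures-19480, line `WallLedgerG`; lane T's zigzag FLUX COUNT, deliverable 1)

HONEST FRAMING. Venture `Summits/Ventures/Crystal3D` (cell `crystal3d-full`), helper `--supports` the crux `GenericWallFloor`
(stmt-Ventures-19480) of `route-Ventures-StickyWulffConstant`, registered line `WallLedgerG`, open stub `stub_twoSlabAdhesion`.
Rung credit only; F-C1 not moved; NOT the stub.  Pure Euclidean geometry and counting in `ℝ³`; nothing about packings.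
Commissioned by planner cf-p1 (ROUTE §86(46), 2026-08-28T14:42:52Z): the flux count of zigzag walker lines through a
periodic Barlow plate is a LINE count for the period-`p` superlattice, whose frame `(Ea, Eb, D)` (in-plane basis, period
vector) has covolume `V = p/√2` and a spacing vector `D` of norm `> 1`; the tree's counts
(`sqrt_two_mul_abs_inner_mul_pi_mul_sq_le_card`, `lineCount_offset_window`) hard-wire `‖Ea‖, ‖Eb‖ ≤ 1`, `‖W‖ = 1`,
`det² = 1/2`, window height `R ≥ 1`.  This file proves the general version:

* `lateral_add_smul` (+ a private `norm_lateral_le_unit`) — the lateral part `v − ⟪v,ν⟫ν` is affine along lines and `1`-Lipschitz;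
* `exists_int_mem_window_of_crossing` — TRANSVERSAL: if `⟪D,ν⟫ ≠ 0` and the window `[lo, lo + R]` has height
  `R ≥ |⟪D,ν⟫|`, the line `P₀ + ℤ D` has a point in the window within lateral distance `‖D‖/2` of its mid-plane crossing
  (nearest integer to the crossing parameter);
* **`lineCount_covolume_window`** — `ν` unit, `Ea, Eb, D, s` ANY vectors with `det(Ea, Eb, D)² = V²`, `V > 0`, window
  `[lo, lo + R]` with `R ≥ |⟪D,ν⟫|`, `ρ ≥ 0`.  If `T ⊆ ℤ²` contains every `(a, b)` for which some integer `t` puts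
  `a•Ea + b•Eb + t•D + s` in `{lo ≤ ⟪p,ν⟫ ≤ lo + R, ‖p‖² − ⟪p,ν⟫² ≤ ρ²}`, then
  `(|⟪D,ν⟫|/V)·π·ρ² − (π/V)·(4(‖Ea‖ + ‖Eb‖)‖D‖ + ‖D‖²)·ρ ≤ #T` — uniform in `ν, s, lo`.
  (fcc bond lines: `V = 1/√2`, `‖D‖ = 1` recovers `√2|⟪W,ν⟫|πρ² − O(ρ)`; hcp zigzag period: `D = 2c·n`, `V = √2`.)

Proof: verbatim the mid-plane-crossing argument of `…NoReconstructionGainLineCount` — crossings with `⟪·,ν⟫ = lo + R/2`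
form the affine lattice `c₀ + aX + bY` in `ν^⊥` (`X, Y` oblique projections of `Ea, Eb` along `D`), the shear identity
`⟪D,ν⟫²·Gram(X, Y) = det(Ea, Eb, D)²` gives `|⟪D,ν⟫|·|det A| = V` in plane coordinates, `affine_disc_count` with cell
diameter `r = ‖X‖ + ‖Y‖`, `|⟪D,ν⟫|·r ≤ 2(‖Ea‖ + ‖Eb‖)‖D‖`, radius `ρ − ‖D‖/2`.

WHAT THIS IS NOT: no lattice enumeration, no zigzag lines yet (deliverable 2); the crux itself is untouched; F-C1 not moved.
-/

noncomputable section

namespace Summit.Ventures.Crystal3D.Theorems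

open Summit.Ventures.Crystal3D Matrix
open scoped InnerProductSpace

/-- The lateral part `v ↦ v − ⟪v,ν⟫ν` is affine along a line: `lat (Q + ε•D) = lat Q + ε • lat D`. -/
theorem lateral_add_smul (ν Q D : EuclideanSpace ℝ (Fin 3)) (ε : ℝ) :
    (Q + ε • D) - ⟪Q + ε • D, ν⟫_ℝ • ν = (Q - ⟪Q, ν⟫_ℝ • ν) + ε • (D - ⟪D, ν⟫_ℝ • ν) := by
  have h : ⟪Q + ε • D, ν⟫_ℝ = ⟪Q, ν⟫_ℝ + ε * ⟪D, ν⟫_ℝ := by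
    rw [inner_add_left, inner_smul_left]; simp
  rw [h]
  module

/-- The lateral part does not increase the norm (`ν` unit): `‖v − ⟪v,ν⟫ν‖ ≤ ‖v‖` (local copy of
`…RefusalCount`'s `norm_lateral_le`, kept private to avoid importing the walker files into pure geometry). -/
private theorem norm_lateral_le_unit (ν v : EuclideanSpace ℝ (Fin 3)) (hν : ‖ν‖ = 1) : ‖v - ⟪v, ν⟫_ℝ • ν‖ ≤ ‖v‖ := by
  have h : ‖v - ⟪v, ν⟫_ℝ • ν‖ ^ 2 ≤ ‖v‖ ^ 2 := by
    rw [norm_sub_inner_smul_sq ν v hν]; nlinarith [sq_nonneg ⟪v, ν⟫_ℝ]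
  exact (pow_le_pow_iff_left₀ (norm_nonneg _) (norm_nonneg _) two_ne_zero).1 h

/-- **Transversal for a general spacing vector.**  `ν` unit, `⟪D, ν⟫ ≠ 0`, window `[lo, lo + R]` of height
`R ≥ |⟪D, ν⟫|`.  If the crossing `Q` of the line `P₀ + ℝ D` with the mid-plane `⟪·,ν⟫ = lo + R/2` has lateral norm `≤ ρ'`,
then the NEAREST INTEGER parameter `t` puts `P₀ + t D` in the window with lateral norm `≤ ρ' + ‖D‖/2`. -/
theorem exists_int_mem_window_of_crossing (ν P₀ D : EuclideanSpace ℝ (Fin 3)) (hν : ‖ν‖ = 1) (hα : ⟪D, ν⟫_ℝ ≠ 0)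
    (R lo ρ' : ℝ) (hR : |⟪D, ν⟫_ℝ| ≤ R)
    (hQ : ‖(P₀ + ((lo + R / 2 - ⟪P₀, ν⟫_ℝ) / ⟪D, ν⟫_ℝ) • D) -
        ⟪P₀ + ((lo + R / 2 - ⟪P₀, ν⟫_ℝ) / ⟪D, ν⟫_ℝ) • D, ν⟫_ℝ • ν‖ ≤ ρ') :
    ∃ t : ℤ, lo ≤ ⟪P₀ + (t : ℝ) • D, ν⟫_ℝ ∧ ⟪P₀ + (t : ℝ) • D, ν⟫_ℝ ≤ lo + R ∧
      ‖(P₀ + (t : ℝ) • D) - ⟪P₀ + (t : ℝ) • D, ν⟫_ℝ • ν‖ ≤ ρ' + ‖D‖ / 2 := by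
  set α : ℝ := ⟪D, ν⟫_ℝ with hαdef
  set s₀ : ℝ := (lo + R / 2 - ⟪P₀, ν⟫_ℝ) / α with hs₀
  set Q : EuclideanSpace ℝ (Fin 3) := P₀ + s₀ • D with hQdef
  set ε : ℝ := ((round s₀ : ℤ) : ℝ) - s₀ with hεdef
  have hε : |ε| ≤ 1 / 2 := by rw [hεdef, abs_sub_comm]; exact abs_sub_round s₀
  have hpt : P₀ + ((round s₀ : ℤ) : ℝ) • D = Q + ε • D := by rw [hQdef, hεdef]; module
  have hQν : ⟪Q, ν⟫_ℝ = lo + R / 2 := by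
    rw [hQdef, inner_add_left, inner_smul_left]; simp only [conj_trivial]; rw [← hαdef, hs₀]; field_simp; ring
  have hin : ⟪P₀ + ((round s₀ : ℤ) : ℝ) • D, ν⟫_ℝ = lo + R / 2 + ε * α := by
    rw [hpt, inner_add_left, inner_smul_left, hQν]; simp [hαdef]
  have hprod : |ε * α| ≤ R / 2 := by
    rw [abs_mul]
    calc |ε| * |α| ≤ 1 / 2 * |α| := mul_le_mul_of_nonneg_right hε (abs_nonneg _)
      _ ≤ R / 2 := by linarith
  obtain ⟨h1, h2⟩ := abs_le.1 hprod
  refine ⟨round s₀, ?_, ?_, ?_⟩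
  · rw [hin]; linarith
  · rw [hin]; linarith
  · rw [hpt, lateral_add_smul ν Q D ε]
    calc ‖Q - ⟪Q, ν⟫_ℝ • ν + ε • (D - ⟪D, ν⟫_ℝ • ν)‖
        ≤ ‖Q - ⟪Q, ν⟫_ℝ • ν‖ + ‖ε • (D - ⟪D, ν⟫_ℝ • ν)‖ := norm_add_le _ _
      _ ≤ ρ' + 1 / 2 * ‖D‖ := by
          rw [norm_smul, Real.norm_eq_abs]
          exact add_le_add hQ (mul_le_mul hε (norm_lateral_le_unit ν D hν) (norm_nonneg _) (by norm_num))
      _ = ρ' + ‖D‖ / 2 := by ring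

/-- **Line count for a general frame (covolume `V`, spacing vector `D`, window `≥ |⟪D,ν⟫|`).**  `ν` unit; `Ea, Eb, D, s`
any vectors of `ℝ³` with `det(Ea, Eb, D)² = V²`, `V > 0`; window `[lo, lo + R]` with `R ≥ |⟪D, ν⟫|`; `ρ ≥ 0`.  If
`T ⊆ ℤ²` contains every `(a, b)` for which some integer `t` puts `a•Ea + b•Eb + t•D + s` in the slab window
`{lo ≤ ⟪p,ν⟫ ≤ lo + R, ‖p‖² − ⟪p,ν⟫² ≤ ρ²}`, then
`(|⟪D,ν⟫| / V)·π·ρ² − (π / V)·(4(‖Ea‖ + ‖Eb‖)‖D‖ + ‖D‖²)·ρ ≤ #T`. -/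
theorem lineCount_covolume_window (ν : EuclideanSpace ℝ (Fin 3)) (hν : ‖ν‖ = 1)
    (R ρ lo V : ℝ) (hV : 0 < V) (hρ : 0 ≤ ρ) (Ea Eb D s : EuclideanSpace ℝ (Fin 3))
    (hdet : (Matrix.det ![WithLp.ofLp Ea, WithLp.ofLp Eb, WithLp.ofLp D]) ^ 2 = V ^ 2)
    (hR : |⟪D, ν⟫_ℝ| ≤ R) (T : Finset (ℤ × ℤ))
    (hT : ∀ a b t : ℤ,
      lo ≤ ⟪(a : ℝ) • Ea + (b : ℝ) • Eb + (t : ℝ) • D + s, ν⟫_ℝ →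
      ⟪(a : ℝ) • Ea + (b : ℝ) • Eb + (t : ℝ) • D + s, ν⟫_ℝ ≤ lo + R →
      ‖(a : ℝ) • Ea + (b : ℝ) • Eb + (t : ℝ) • D + s‖ ^ 2 -
          ⟪(a : ℝ) • Ea + (b : ℝ) • Eb + (t : ℝ) • D + s, ν⟫_ℝ ^ 2 ≤ ρ ^ 2 →
      (a, b) ∈ T) :
    |⟪D, ν⟫_ℝ| / V * Real.pi * ρ ^ 2 - Real.pi / V * (4 * (‖Ea‖ + ‖Eb‖) * ‖D‖ + ‖D‖ ^ 2) * ρ ≤ (T.card : ℝ) := by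
  have hTnn : (0 : ℝ) ≤ (T.card : ℝ) := Nat.cast_nonneg _
  have hπV : 0 < Real.pi / V := div_pos Real.pi_pos hV
  set α : ℝ := ⟪D, ν⟫_ℝ with hαdef
  set m : ℝ := lo + R / 2 with hmdef
  set d : ℝ := ‖D‖ with hddef
  have hd0 : 0 ≤ d := norm_nonneg _
  -- |α| ≤ ‖D‖, |⟪Ea,ν⟫| ≤ ‖Ea‖, |⟪Eb,ν⟫| ≤ ‖Eb‖
  have hαle : |α| ≤ d := by
    have h := abs_real_inner_le_norm D ν; rw [hν, mul_one] at h; exact h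
  have hEaν : |⟪Ea, ν⟫_ℝ| ≤ ‖Ea‖ := by
    have h := abs_real_inner_le_norm Ea ν; rw [hν, mul_one] at h; exact h
  have hEbν : |⟪Eb, ν⟫_ℝ| ≤ ‖Eb‖ := by
    have h := abs_real_inner_le_norm Eb ν; rw [hν, mul_one] at h; exact h
  -- the error constant dominates the main term for small ρ; also the α = 0 case
  have hC0 : 0 ≤ Real.pi / V * (4 * (‖Ea‖ + ‖Eb‖) * d + d ^ 2) * ρ := by positivity
  by_cases hα0 : α = 0
  · rw [hα0, abs_zero, zero_div, zero_mul, zero_mul, zero_sub]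
    linarith
  have hαpos : 0 < |α| := abs_pos.2 hα0
  -- the oblique projections and the (lateral) centre
  set X : EuclideanSpace ℝ (Fin 3) := Ea - (⟪Ea, ν⟫_ℝ / α) • D with hX
  set Y : EuclideanSpace ℝ (Fin 3) := Eb - (⟪Eb, ν⟫_ℝ / α) • D with hY
  set c₀ : EuclideanSpace ℝ (Fin 3) := s + ((m - ⟪s, ν⟫_ℝ) / α) • D - m • ν with hc₀
  have hνν : ⟪ν, ν⟫_ℝ = 1 := by rw [real_inner_self_eq_norm_sq, hν, one_pow]
  have hXν : ⟪X, ν⟫_ℝ = 0 := by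
    rw [hX, inner_sub_left, inner_smul_left]; simp only [conj_trivial]; rw [← hαdef]; field_simp; ring
  have hYν : ⟪Y, ν⟫_ℝ = 0 := by
    rw [hY, inner_sub_left, inner_smul_left]; simp only [conj_trivial]; rw [← hαdef]; field_simp; ring
  have hc₀ν : ⟪c₀, ν⟫_ℝ = 0 := by
    rw [hc₀, inner_sub_left, inner_add_left, inner_smul_left, inner_smul_left]; simp only [conj_trivial]
    rw [hνν, ← hαdef]; field_simp; ring
  -- norms of X, Y: |α| ‖X‖ ≤ 2 ‖Ea‖ ‖D‖
  have hXn : |α| * ‖X‖ ≤ 2 * ‖Ea‖ * d := by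
    have h1 : |α| * ‖X‖ = ‖α • Ea - ⟪Ea, ν⟫_ℝ • D‖ := by
      rw [← Real.norm_eq_abs, ← norm_smul, hX, smul_sub, smul_smul, mul_div_cancel₀ _ hα0]
    rw [h1]
    have h2 : ‖α • Ea - ⟪Ea, ν⟫_ℝ • D‖ ≤ |α| * ‖Ea‖ + |⟪Ea, ν⟫_ℝ| * d := by
      calc ‖α • Ea - ⟪Ea, ν⟫_ℝ • D‖ ≤ ‖α • Ea‖ + ‖⟪Ea, ν⟫_ℝ • D‖ := norm_sub_le _ _
        _ = |α| * ‖Ea‖ + |⟪Ea, ν⟫_ℝ| * d := by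
            rw [norm_smul, norm_smul, Real.norm_eq_abs, Real.norm_eq_abs]
    have h3 : |α| * ‖Ea‖ ≤ d * ‖Ea‖ := mul_le_mul_of_nonneg_right hαle (norm_nonneg _)
    have h4 : |⟪Ea, ν⟫_ℝ| * d ≤ ‖Ea‖ * d := mul_le_mul_of_nonneg_right hEaν hd0
    linarith
  have hYn : |α| * ‖Y‖ ≤ 2 * ‖Eb‖ * d := by
    have h1 : |α| * ‖Y‖ = ‖α • Eb - ⟪Eb, ν⟫_ℝ • D‖ := by
      rw [← Real.norm_eq_abs, ← norm_smul, hY, smul_sub, smul_smul, mul_div_cancel₀ _ hα0]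
    rw [h1]
    have h2 : ‖α • Eb - ⟪Eb, ν⟫_ℝ • D‖ ≤ |α| * ‖Eb‖ + |⟪Eb, ν⟫_ℝ| * d := by
      calc ‖α • Eb - ⟪Eb, ν⟫_ℝ • D‖ ≤ ‖α • Eb‖ + ‖⟪Eb, ν⟫_ℝ • D‖ := norm_sub_le _ _
        _ = |α| * ‖Eb‖ + |⟪Eb, ν⟫_ℝ| * d := by
            rw [norm_smul, norm_smul, Real.norm_eq_abs, Real.norm_eq_abs]
    have h3 : |α| * ‖Eb‖ ≤ d * ‖Eb‖ := mul_le_mul_of_nonneg_right hαle (norm_nonneg _)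
    have h4 : |⟪Eb, ν⟫_ℝ| * d ≤ ‖Eb‖ * d := mul_le_mul_of_nonneg_right hEbν hd0
    linarith
  set r : ℝ := ‖X‖ + ‖Y‖ with hr
  have hr0 : 0 ≤ r := by positivity
  have hαr : |α| * r ≤ 2 * (‖Ea‖ + ‖Eb‖) * d := by rw [hr]; linarith
  -- effective radius
  set ρ' : ℝ := ρ - d / 2 with hρ'def
  -- the small-ρ case is trivial
  by_cases hrρ : ρ' < r
  · -- |α| ρ ≤ |α| (r + d/2) ≤ 2(‖Ea‖+‖Eb‖) d + d²/2
    have h1 : |α| * ρ ≤ 2 * (‖Ea‖ + ‖Eb‖) * d + d ^ 2 := by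
      have h5 : |α| * ρ < |α| * (r + d / 2) := by
        apply mul_lt_mul_of_pos_left _ hαpos; rw [hρ'def] at hrρ; linarith
      have h6 : |α| * d ≤ d * d := mul_le_mul_of_nonneg_right hαle hd0
      have h7 : |α| * (r + d / 2) = |α| * r + (|α| * d) / 2 := by ring
      nlinarith
    have h2 : |α| / V * Real.pi * ρ ^ 2 = Real.pi / V * (|α| * ρ) * ρ := by ring
    have h3 : Real.pi / V * (|α| * ρ) * ρ ≤ Real.pi / V * (4 * (‖Ea‖ + ‖Eb‖) * d + d ^ 2) * ρ := by
      apply mul_le_mul_of_nonneg_right _ hρ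
      apply mul_le_mul_of_nonneg_left _ hπV.le
      nlinarith [norm_nonneg Ea, norm_nonneg Eb]
    linarith
  push Not at hrρ
  have hρ'0 : 0 ≤ ρ' := hr0.trans hrρ
  -- plane coordinates
  obtain ⟨A, β, hAβ, hdetA, hAf⟩ := exists_planeCoordinates ν X Y c₀ hν hXν hYν hc₀ν
  -- Gram identity ⇒ |α| |det A| = V
  have hgram := sq_mul_gram_shear_euclidean Ea Eb D ν hα0
  rw [← hαdef, ← hX, ← hY, hdet, hν, one_pow, mul_one, ← hdetA] at hgram
  have hdetabs : |α| * |A.det| = V := by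
    have hnn : 0 ≤ |α| * |A.det| := by positivity
    have hsq : (|α| * |A.det|) ^ 2 = V ^ 2 := by rw [mul_pow, sq_abs, sq_abs]; exact hgram
    exact (pow_left_inj₀ hnn hV.le two_ne_zero).1 hsq
  have hAdet : A.det ≠ 0 := by
    intro h; rw [h, abs_zero, mul_zero] at hdetabs; exact hV.ne' hdetabs.symm
  -- the affine disc count
  have hbound : ∀ f : Fin 2 → ℝ, (∀ i, 0 ≤ f i ∧ f i < 1) →
      (A.mulVec f 0) ^ 2 + (A.mulVec f 1) ^ 2 ≤ r ^ 2 := by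
    intro f hf
    rw [hAf]
    have h0 := hf 0; have h1 := hf 1
    have hle : ‖f 0 • X + f 1 • Y‖ ≤ r := by
      calc ‖f 0 • X + f 1 • Y‖ ≤ ‖f 0 • X‖ + ‖f 1 • Y‖ := norm_add_le _ _
        _ = |f 0| * ‖X‖ + |f 1| * ‖Y‖ := by rw [norm_smul, norm_smul, Real.norm_eq_abs, Real.norm_eq_abs]
        _ ≤ 1 * ‖X‖ + 1 * ‖Y‖ := by
            gcongr
            · rw [abs_of_nonneg h0.1]; exact h0.2.le
            · rw [abs_of_nonneg h1.1]; exact h1.2.le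
        _ = r := by rw [hr]; ring
    exact pow_le_pow_left₀ (norm_nonneg _) hle 2
  have hdisc := affine_disc_count A hAdet β 0 r ρ' hr0 hrρ hbound T ?_
  swap
  · intro i j hij
    simp only [Pi.zero_apply, sub_zero] at hij
    -- the mid-plane crossing of the line (i, j) has lateral norm ≤ ρ'
    have hlat : ‖c₀ + (i : ℝ) • X + (j : ℝ) • Y‖ ≤ ρ' := by
      have h2 : ‖c₀ + (i : ℝ) • X + (j : ℝ) • Y‖ ^ 2 ≤ ρ' ^ 2 := by rw [hAβ]; exact hij
      exact (pow_le_pow_iff_left₀ (norm_nonneg _) hρ'0 two_ne_zero).1 h2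
    set P₀ : EuclideanSpace ℝ (Fin 3) := (i : ℝ) • Ea + (j : ℝ) • Eb + s with hP₀
    have hQ : ‖(P₀ + ((lo + R / 2 - ⟪P₀, ν⟫_ℝ) / ⟪D, ν⟫_ℝ) • D) -
        ⟪P₀ + ((lo + R / 2 - ⟪P₀, ν⟫_ℝ) / ⟪D, ν⟫_ℝ) • D, ν⟫_ℝ • ν‖ ≤ ρ' := by
      have hP₀ν : ⟪P₀, ν⟫_ℝ = (i : ℝ) * ⟪Ea, ν⟫_ℝ + (j : ℝ) * ⟪Eb, ν⟫_ℝ + ⟪s, ν⟫_ℝ := by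
        rw [hP₀, inner_add_left, inner_add_left, inner_smul_left, inner_smul_left]; simp
      have heq : P₀ + ((lo + R / 2 - ⟪P₀, ν⟫_ℝ) / ⟪D, ν⟫_ℝ) • D -
          ⟪P₀ + ((lo + R / 2 - ⟪P₀, ν⟫_ℝ) / ⟪D, ν⟫_ℝ) • D, ν⟫_ℝ • ν =
          c₀ + (i : ℝ) • X + (j : ℝ) • Y := by
        have hin : ⟪P₀ + ((lo + R / 2 - ⟪P₀, ν⟫_ℝ) / ⟪D, ν⟫_ℝ) • D, ν⟫_ℝ = m := by
          rw [inner_add_left, inner_smul_left]; simp only [conj_trivial]; rw [← hαdef, hmdef]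
          field_simp; ring
        rw [hin, ← hmdef, hP₀ν, ← hαdef, hc₀, hX, hY, hP₀]
        have e1 : (m - ((i : ℝ) * ⟪Ea, ν⟫_ℝ + (j : ℝ) * ⟪Eb, ν⟫_ℝ + ⟪s, ν⟫_ℝ)) / α =
            -((i : ℝ) * (⟪Ea, ν⟫_ℝ / α)) - (j : ℝ) * (⟪Eb, ν⟫_ℝ / α) + (m - ⟪s, ν⟫_ℝ) / α := by
          field_simp; ring
        rw [e1]
        module
      rw [heq]; exact hlat
    obtain ⟨t, ht1, ht2, ht3⟩ := exists_int_mem_window_of_crossing ν P₀ D hν hα0 R lo ρ' hR hQ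
    have hpt : P₀ + (t : ℝ) • D = (i : ℝ) • Ea + (j : ℝ) • Eb + (t : ℝ) • D + s := by
      rw [hP₀]; abel
    rw [hpt] at ht1 ht2 ht3
    refine hT i j t ht1 ht2 ?_
    rw [← norm_sub_inner_smul_sq ν _ hν]
    have hρeq : ρ' + ‖D‖ / 2 = ρ := by rw [hρ'def, hddef]; ring
    rw [hρeq] at ht3
    exact pow_le_pow_left₀ (norm_nonneg _) ht3 2
  -- assemble: (|α|/V) π (ρ'-r)² ≤ #T
  have hmain : |α| / V * (Real.pi * (ρ' - r) ^ 2) ≤ (T.card : ℝ) := by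
    have h := mul_le_mul_of_nonneg_left hdisc (by positivity : (0 : ℝ) ≤ |α| / V)
    calc |α| / V * (Real.pi * (ρ' - r) ^ 2)
        ≤ |α| / V * (|A.det| * (T.card : ℝ)) := h
      _ = (|α| * |A.det|) / V * (T.card : ℝ) := by ring
      _ = (T.card : ℝ) := by rw [hdetabs, div_self hV.ne', one_mul]
  -- |α| (ρ'-r)² ≥ |α| ρ² - (4(‖Ea‖+‖Eb‖) d + d²) ρ
  have hexp : |α| * ρ ^ 2 - (4 * (‖Ea‖ + ‖Eb‖) * d + d ^ 2) * ρ ≤ |α| * (ρ' - r) ^ 2 := by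
    have e : |α| * (ρ' - r) ^ 2 = |α| * ρ ^ 2 - (|α| * d) * ρ - 2 * (|α| * r) * ρ' + |α| * (d ^ 2 / 4 + r ^ 2) := by
      rw [hρ'def]; ring
    have h1 : (|α| * d) * ρ ≤ d ^ 2 * ρ := by
      apply mul_le_mul_of_nonneg_right _ hρ
      rw [sq]; exact mul_le_mul_of_nonneg_right hαle hd0
    have h2 : 2 * (|α| * r) * ρ' ≤ 2 * (2 * (‖Ea‖ + ‖Eb‖) * d) * ρ := by
      have hρ'le : ρ' ≤ ρ := by rw [hρ'def]; linarith
      calc 2 * (|α| * r) * ρ' ≤ 2 * (2 * (‖Ea‖ + ‖Eb‖) * d) * ρ' := by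
            apply mul_le_mul_of_nonneg_right _ hρ'0; linarith
        _ ≤ 2 * (2 * (‖Ea‖ + ‖Eb‖) * d) * ρ := by
            apply mul_le_mul_of_nonneg_left hρ'le; positivity
    have h3 : 0 ≤ |α| * (d ^ 2 / 4 + r ^ 2) := by positivity
    rw [e]; linarith
  have hfin : |α| / V * Real.pi * ρ ^ 2 - Real.pi / V * (4 * (‖Ea‖ + ‖Eb‖) * d + d ^ 2) * ρ =
      Real.pi / V * (|α| * ρ ^ 2 - (4 * (‖Ea‖ + ‖Eb‖) * d + d ^ 2) * ρ) := by ring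
  have hfin2 : |α| / V * (Real.pi * (ρ' - r) ^ 2) = Real.pi / V * (|α| * (ρ' - r) ^ 2) := by ring
  rw [hfin]
  rw [hfin2] at hmain
  exact (mul_le_mul_of_nonneg_left hexp hπV.le).trans hmain

end Summit.Ventures.Crystal3D.Theorems

end
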